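import Summits.HubbardSuperconductivity.HubbardSuperconductivity.Theorems.AnisotropyChordTransferFibre3KreinBackward

/-!
# Route `AnisotropyChord` / H0 rotor rung: PORT N30-A revised targets — THE KREIN–JF IDENTITY PROVED (`L ≥ 4`)

Memo ROTOR-THEORY-20 §282 (theory seat `hubbard-h0-rotor-theory-1`, cycle 20): for every symmetric `Ψ` vanishing on the
hard core with `⟨v,Ψ⟩ = 3V²`, every `Δ` and every `T < 2ε₁`,
`S(−q) = 3V²T + Re⟨Ψ,(H−E)Ψ⟩ − Re⟨R′, G_T R′⟩`, `q` the Krein charge, `R′` the off-`D` residual —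
**`kreinJFIdentity_holds (hL : 4 ≤ L) (Δ : ℝ) : KreinJFIdentity L Δ`** (numerically cross-checked, job j333109).
Proof: with `ρ := (H₀−E)Ψ` one has `ρ = R′ + q̂` (`q̂` = the charge read on the fibre), `Ψ = v + G_Tρ` (pole part of a
symmetric `Ψ` is `(⟨v,Ψ⟩/3V²)v = v`), `⟨v,ρ⟩ = −3V²T`, `⟨q,𝒩q⟩ = ⟨q̂,G_T q̂⟩ − Σ_S ΔW|Ψ|²`, `⟨ρ, G_T q̂⟩ = conj⟨q̂, Ψ − v⟩`,
`⟨q̂,Ψ⟩ = Σ_S ΔW|Ψ|²`; the rest is bookkeeping of real parts.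
Prover seat `hubbard-h0-rotor-p1` g21; helper for stmt-HubbardSuperconductivity-19089 (`--supports`).
-/

set_option linter.dupNamespace false
set_option autoImplicit false

noncomputable section

open scoped BigOperators
open Complex Matrix

namespace Summit.HubbardSuperconductivity.HubbardSuperconductivity.Theorems.AnisotropyChord.Transfer.Fibre3

variable (L : ℕ) [NeZero L]

/-! ## `Gform` algebra -/

/-- `G[A,B] = ⟨A, G_T B⟩`. [folklore] -/
theorem Gform_eq_ip (T : ℝ) (A B : Cfg L → ℂ) : Gform L T A B = ip L A (Gapply L T B) := by
  unfold Gform ip Gapply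
  refine Finset.sum_congr rfl fun c _ => ?_
  rw [Finset.mul_sum]
  refine Finset.sum_congr rfl fun c' _ => ?_
  ring

/-- `⟨G_T B, A⟩ = ⟨B, G_T A⟩` (`G_T` Hermitian). [folklore] -/
theorem ip_Gapply_left (T : ℝ) (A B : Cfg L → ℂ) : ip L (Gapply L T B) A = ip L B (Gapply L T A) := by
  unfold ip Gapply
  simp_rw [map_sum, map_mul, Finset.sum_mul, Finset.mul_sum]
  rw [Finset.sum_comm]
  refine Finset.sum_congr rfl fun c' _ => Finset.sum_congr rfl fun c _ => ?_
  rw [← conj_Gentry L T c' c]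
  ring

/-- `conj G[A,B] = G[B,A]`. [folklore] -/
theorem conj_Gform (T : ℝ) (A B : Cfg L → ℂ) : (starRingEnd ℂ) (Gform L T A B) = Gform L T B A := by
  rw [Gform_eq_ip, Gform_eq_ip, conj_ip, ip_Gapply_left]

/-- [folklore] -/
theorem Gapply_add (T : ℝ) (A B : Cfg L → ℂ) (c : Cfg L) :
    Gapply L T (fun d => A d + B d) c = Gapply L T A c + Gapply L T B c := by
  unfold Gapply; rw [← Finset.sum_add_distrib]; refine Finset.sum_congr rfl fun c' _ => ?_; ring

/-- [folklore] -/
theorem Gform_add_add (T : ℝ) (A B : Cfg L → ℂ) :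
    Gform L T (fun c => A c + B c) (fun c => A c + B c) = Gform L T A A + Gform L T A B + Gform L T B A + Gform L T B B := by
  rw [Gform_eq_ip, Gform_eq_ip, Gform_eq_ip, Gform_eq_ip, Gform_eq_ip]
  unfold ip
  simp_rw [Gapply_add]
  rw [← Finset.sum_add_distrib, ← Finset.sum_add_distrib, ← Finset.sum_add_distrib]
  refine Finset.sum_congr rfl fun c _ => ?_
  rw [map_add]; ring

/-! ## The identity -/

/-- **THE KREIN–JF IDENTITY holds** (`L ≥ 4`, every `Δ`). [folklore] -/
theorem kreinJFIdentity_holds (hL : 4 ≤ L) (Δ : ℝ) : KreinJFIdentity L Δ := by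
  classical
  intro T hT Ψ hsym hD hv
  have hL2 : 2 ≤ L := by omega
  have hV : (3 * ((L : ℂ) ^ 2) ^ 2) ≠ 0 := by
    have : (L : ℂ) ≠ 0 := by exact_mod_cast (NeZero.ne L)
    exact mul_ne_zero (by norm_num) (pow_ne_zero _ (pow_ne_zero _ this))
  have hv' : ip L (vfun L) Ψ = 3 * ((L : ℂ) ^ 2) ^ 2 := hv
  -- the objects
  set E : ℂ := ((eps1 L + T : ℝ) : ℂ) with hE
  set ρ : Cfg L → ℂ := fun c => H0apply L (K1 L) Ψ c - E * Ψ c with hρ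
  set qh : Cfg L → ℂ := fun c => if InD L c = true then ρ c else (Δ : ℂ) * (Wcount L c : ℂ) * Ψ c with hqh
  set R : Cfg L → ℂ := residual L T Δ Ψ with hR
  set q : DS L → ℂ := kreinCharge L T Δ Ψ with hq
  -- pointwise facts
  have hR_eq : ∀ c, R c = if InD L c = true then 0 else ρ c - (Δ : ℂ) * (Wcount L c : ℂ) * Ψ c := by
    intro c; simp only [hR, residual, Happly, hρ]
    split_ifs <;> ring
  have hdec : ∀ c, ρ c = R c + qh c := by
    intro c; rw [hR_eq]; simp only [hqh]
    split_ifs <;> ring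
  have hq_eq : ∀ j : DS L, q j = qh (cfgOf L j) := by
    rintro (d | s)
    · have h1 : qh d.1 = ρ d.1 := by simp only [hqh]; rw [if_pos d.2]
      show kreinCharge L T Δ Ψ (Sum.inl d) = qh d.1
      rw [h1]; rfl
    · have h1 : qh s.1 = (Δ : ℂ) * (Wcount L s.1 : ℂ) * Ψ s.1 := by
        simp only [hqh]; rw [if_neg (by simp [InD_false_of_InS L s.2])]
      show kreinCharge L T Δ Ψ (Sum.inr s) = qh s.1
      rw [h1]; rfl
  have hqh0 : ∀ c, InD L c = false → InS L c = false → qh c = 0 := by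
    intro c hDc hSc
    simp only [hqh, hDc, Bool.false_eq_true, if_false, Wcount_eq_zero L hDc hSc, Nat.cast_zero, mul_zero, zero_mul]
  -- (i) Ψ = v + G ρ
  have hGρ : ∀ c, Gapply L T ρ c = Ψ c - vfun L c := by
    intro c
    have e := Gapply_H0E L hL hT Ψ c
    rw [PiPole_symm L hL2 hsym, hv', div_self hV, one_mul] at e
    exact e
  -- (ii) ⟨v, ρ⟩ = −3V²T
  have hvρ : ip L (vfun L) ρ = -(3 * ((L : ℂ) ^ 2) ^ 2 * (T : ℂ)) := by
    have e1 : ip L (vfun L) ρ = ip L (vfun L) (H0apply L (K1 L) Ψ) - E * ip L (vfun L) Ψ := by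
      simp only [hρ]; unfold ip
      rw [Finset.mul_sum, ← Finset.sum_sub_distrib]
      refine Finset.sum_congr rfl fun c _ => ?_; ring
    rw [e1, ip_vfun_H0apply L hL2, hv', hE]; push_cast; ring
  -- the S-term
  set Sterm : ℂ := ip L Ψ (fun c => (Δ : ℂ) * (Wcount L c : ℂ) * Ψ c) with hS
  have hqhΨ : ip L qh Ψ = Sterm := by
    simp only [hS]; unfold ip
    refine Finset.sum_congr rfl fun c _ => ?_
    simp only [hqh]
    split_ifs with h
    · rw [hD c h]; ring
    · rw [map_mul, map_mul, Complex.conj_ofReal, Complex.conj_natCast]; ring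
  -- (v) ⟨q, 𝒩 q⟩ and ⟨q, v⟩ on D ⊕ S
  have hqv : star q ⬝ᵥ vpole L = (starRingEnd ℂ) (ip L (vfun L) qh) := by
    rw [conj_ip]
    unfold ip
    rw [← sum_DS_eq L (fun c => (starRingEnd ℂ) (qh c) * vfun L c) (fun c hDc hSc => by rw [hqh0 c hDc hSc]; simp)]
    simp only [dotProduct, Pi.star_apply, star_def, hq_eq]
    rfl
  have hqN : star q ⬝ᵥ Nmat L T Δ *ᵥ q = Gform L T qh qh - Sterm := by
    rw [Gform_eq_ip]
    have hGq : ∀ i : DS L, (Nmat L T Δ *ᵥ q) i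
        = Gapply L T qh (cfgOf L i) - (match i with
          | Sum.inl _ => 0
          | Sum.inr s => (((1 / (Δ * (Wcount L s.1 : ℝ))) : ℝ) : ℂ) * q (Sum.inr s)) := by
      rintro (d | s)
      · rw [Nmat_mulVec_inl]; simp_rw [hq_eq]; rw [sum_Gentry_DS L T qh hqh0]; simp [cfgOf]
      · rw [Nmat_mulVec_inr]; simp_rw [hq_eq]; rw [sum_Gentry_DS L T qh hqh0]; simp [cfgOf]
    simp only [dotProduct, Pi.star_apply, star_def]
    simp_rw [hGq, mul_sub]
    rw [Finset.sum_sub_distrib]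
    congr 1
    · unfold ip
      rw [← sum_DS_eq L (fun c => (starRingEnd ℂ) (qh c) * Gapply L T qh c)
        (fun c hDc hSc => by rw [hqh0 c hDc hSc]; simp)]
      simp_rw [hq_eq]
    · rw [Fintype.sum_sum_type]
      simp only [mul_zero, Finset.sum_const_zero, zero_add]
      simp only [hS]; unfold ip
      rw [← sum_DS_eq L (fun c => (starRingEnd ℂ) (Ψ c) * ((Δ : ℂ) * (Wcount L c : ℂ) * Ψ c))
        (fun c hDc hSc => by rw [Wcount_eq_zero L hDc hSc]; simp), Fintype.sum_sum_type]
      have hDzero : ∑ d : {c : Cfg L // InD L c = true},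
          (starRingEnd ℂ) (Ψ (cfgOf L (Sum.inl d))) * ((Δ : ℂ) * (Wcount L (cfgOf L (Sum.inl d)) : ℂ) * Ψ (cfgOf L (Sum.inl d)))
          = 0 := Finset.sum_eq_zero fun d _ => by simp [cfgOf, hD d.1 d.2]
      rw [hDzero, zero_add]
      refine Finset.sum_congr rfl fun s _ => ?_
      simp only [hq_eq, cfgOf, hqh, InD_false_of_InS L s.2, Bool.false_eq_true, if_false]
      by_cases hΔ : Δ = 0
      · subst hΔ; simp
      · have hW : (Wcount L s.1 : ℂ) ≠ 0 := by
          have := Wcount_pos_of_InS L s.2; exact_mod_cast (by omega : Wcount L s.1 ≠ 0)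
        have hΔ' : (Δ : ℂ) ≠ 0 := by exact_mod_cast hΔ
        rw [map_mul, map_mul, Complex.conj_ofReal, Complex.conj_natCast]
        push_cast
        field_simp
  -- (iii) ⟨Ψ, (H − E)Ψ⟩ = −3V²T + G[ρ,ρ] − Sterm
  have hR1 : ip L Ψ (fun c => Happly L (K1 L) Δ Ψ c - ((eps1 L + T : ℝ) : ℂ) * Ψ c)
      = -(3 * ((L : ℂ) ^ 2) ^ 2 * (T : ℂ)) + Gform L T ρ ρ - Sterm := by
    have e1 : ip L Ψ (fun c => Happly L (K1 L) Δ Ψ c - ((eps1 L + T : ℝ) : ℂ) * Ψ c) = ip L Ψ ρ - Sterm := by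
      simp only [hS, hρ, ip, Happly]
      rw [← Finset.sum_sub_distrib]
      refine Finset.sum_congr rfl fun c _ => ?_; rw [← hE]; ring
    have e2 : ip L Ψ ρ = ip L (vfun L) ρ + ip L (Gapply L T ρ) ρ := by
      unfold ip; rw [← Finset.sum_add_distrib]
      refine Finset.sum_congr rfl fun c _ => ?_
      rw [hGρ c, map_sub]; ring
    rw [e1, e2, hvρ, ip_Gapply_left, ← Gform_eq_ip]
  -- (iv) G[ρ,ρ] expanded along ρ = R + qh, and G[ρ, qh]
  have hρfun : ρ = fun c => R c + qh c := funext hdec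
  have hGρρ : Gform L T ρ ρ = Gform L T R R + Gform L T R qh + (starRingEnd ℂ) (Gform L T R qh) + Gform L T qh qh := by
    rw [conj_Gform]
    conv_lhs => rw [hρfun]
    rw [Gform_add_add]
  have hGRq : Gform L T R qh = (starRingEnd ℂ) Sterm - ip L (vfun L) qh - Gform L T qh qh := by
    -- G[ρ, qh] = conj ⟨qh, Gρ⟩ = conj ⟨qh, Ψ − v⟩
    have e1 : Gform L T ρ qh = (starRingEnd ℂ) (ip L qh Ψ) - (starRingEnd ℂ) (ip L qh (vfun L)) := by
      rw [Gform_eq_ip, ← conj_ip, ip_Gapply_left]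
      rw [← map_sub]; congr 1
      unfold ip; rw [← Finset.sum_sub_distrib]
      refine Finset.sum_congr rfl fun c _ => ?_; rw [hGρ c]; ring
    have e2 : Gform L T ρ qh = Gform L T R qh + Gform L T qh qh := by
      rw [hρfun, Gform_eq_ip, Gform_eq_ip, Gform_eq_ip]
      show ip L (R + qh) _ = _
      rw [ip_add_left]
    rw [hqhΨ, conj_ip L (vfun L) qh] at e1
    linear_combination e1 - e2
  -- assemble (real parts)
  unfold saddleS
  rw [star_neg, neg_dotProduct, Matrix.mulVec_neg, dotProduct_neg, neg_dotProduct, neg_neg, hqv, hqN, hR1, hGρρ, hGRq]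
  simp only [Complex.neg_re, Complex.sub_re, Complex.add_re, Complex.conj_re]
  have e3 : ((3 : ℂ) * ((L : ℂ) ^ 2) ^ 2 * (T : ℂ)).re = 3 * ((L : ℝ) ^ 2) ^ 2 * T := by
    rw [show ((3 : ℂ) * ((L : ℂ) ^ 2) ^ 2 * (T : ℂ)) = ((3 * ((L : ℝ) ^ 2) ^ 2 * T : ℝ) : ℂ) by push_cast; ring,
      Complex.ofReal_re]
  rw [e3]
  ring

end Summit.HubbardSuperconductivity.HubbardSuperconductivity.Theorems.AnisotropyChord.Transfer.Fibre3

end
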